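import Literature.AlgebraicGeometry.Resolution.Hironaka1970RationalNearPointCylinder
import HarnessLib

/-!
# Hironaka 1970 (Kyoto), (13.2) at a RATIONAL point: `U_{g,x'} = K[X_σ]`, the Hironaka scheme `B_{g,x'}`
# is the line through `x'`, and the readings of «`C_{X,x}` invariant by `B_{g,x'}`» coincide

Topic: `Literature/AlgebraicGeometry/Resolution` (part 2 of stage S1b of the cell res-hironaka reading of
[H4] Th. IV; continues `Hironaka1970RationalNearPointCylinder.lean`, same coordinates: cone
`K[X_0, X_σ] = MvPolynomial (Option σ) K`, rational point `x' = [1 : 0 : ⋯ : 0]`, `𝔭_{x'} = (X_σ)`).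

Source: H. Hironaka, *Certain numerical characters of singularities*, J. Math. Kyoto Univ. 10 (1970)
151–187 [`Hironaka1970NumericalCharacters`], (13.2) p. 168 L32–38, read on the page (held text
`paper:hironaka1970-certain-numerical-characters-singularities`, p0018): «`U_{g,x'} = K[θ_1, θ_2, …, θ_e]`
where `θ_i = X_i^{q_i} + Σ_j c_{ij} X_j^{q_i}` with … `c_{ij} ∈ K` … If the characteristic `p` of `K` is
positive, then all the `q_i` are necessarily powers of `p`. If `p = 0`, then `q_i = 1` for all `i`.»;
p. 170 L3–4: «`C_{X,x}` is invariant by `B_{g,x'}` if and only if the ideal of `C_{X,x}` in `gr_x(Z)` is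
generated by elements of `U_{g,x'}`»; H. Mizutani, Nagoya Math. J. 52 (1973), Def. 1.1 p. 85 L29 – p. 86 L2
(`B_{P,p} = Spec(S/U_+(p)S)`) and Rem. 1.2 [`Mizutani1973HironakaGroupSchemes`].

## What is proved (pure graded algebra; the `X_σ`-degree grading of `K[X_0, X_σ]`)

At a `K`-RATIONAL point the `θ_i` of (13.2) are LINEAR in every characteristic: for the point
`x' = [1:0:⋯:0]` with homogeneous prime `𝔭_{x'} = (X_σ)`,

* `multGens_span_X_some_subset_range_rename` — a form `φ` of degree `d` with `mult_{x'}(φ) ≥ d` (i.e.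
  `s·φ ∈ 𝔭_{x'}^d` for some `s ∉ 𝔭_{x'}`, `HironakaScheme.symbPow`) involves the `X_σ` only: with `k₀` the least
  `X_σ`-degree occurring in `φ`, the `X_σ`-degree-`k₀` part of `s·φ` is `s(X_0, 0)·φ^{(k₀)} ≠ 0`, and
  `s φ ∈ (X_σ)^d` forces `k₀ ≥ d = deg φ`;
* `multAlgebra_span_X_some_eq_range_rename` — **`U(𝔭_{x'}) = K[X_σ]`** (`HironakaScheme.multAlgebra`);
* `bIdeal_span_X_some_eq`, `isVectorGroup_span_X_some` — **`U_+(𝔭_{x'})·K[X] = 𝔭_{x'}`: the Hironaka scheme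
  `B_{g,x'}` is the line through `x'`, a vector group** (no appeal to Mizutani's dimension bound is needed at
  a rational point);
* `le_span_inter_multAlgebra_iff_le_span_inter_range_rename`, `forall_finrank_eq_iff_le_span_inter_multAlgebra`
  — the readings of «invariant by `B_{g,x'}`» coincide at a rational point: generated by `U(𝔭_{x'})` ⟺
  cylinder along `x'` ⟺ (for homogeneous `J`) the TH II equality of
  `Hironaka1970RationalNearPointCylinder.lean` for every `n`.

Tool: the weight `X_0 ↦ 0`, `X_σ ↦ 1` (Mathlib `Finsupp.weight`, `weightedHomogeneousComponent`), spelled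
out inline. Nothing here concerns any manuscript under review. AI-written; AI review is weaker than expert
review.

## References

* H. Hironaka, J. Math. Kyoto Univ. 10 (1970) 151–187: (13.1)–(13.2) p. 168, (14.3) p. 170 L3–9, TH III–IV
  p. 156. [Hironaka1970NumericalCharacters]
* H. Mizutani, Nagoya Math. J. 52 (1973) 85–95: Def. 1.1, Rem. 1.2. [Mizutani1973HironakaGroupSchemes]
-/

noncomputable section

open MvPolynomial Module
open Literature.RingTheory.MvPolynomial Literature.RingTheory.MvPolynomial.IdealHomogenization

namespace Literature.AlgebraicGeometry.Resolution

universe u v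

variable {K : Type u} [Field K] {σ : Type v}

/-! ## (13.2) at a rational point: `U(𝔭_{x'}) = K[X_σ]`, so `B_{g,x'}` is the line `x'`

[H4] (13.2) p. 168 L32–38: «`U_{g,x'} = K[θ_1, …, θ_e]` where `θ_i = X_i^{q_i} + Σ_j c_{ij} X_j^{q_i}` … If
`p = 0`, then `q_i = 1` for all `i`»; at a `K`-RATIONAL point the same happens in every characteristic:
the `θ_i` are the linear forms vanishing at `x'`. In the coordinates of this file (`x' = [1:0:⋯:0]`,
`𝔭_{x'} = (X_σ)`): a form of degree `d` has multiplicity `≥ d` at `x'` iff it involves the `X_σ` only,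
so `U(𝔭_{x'})` is the image of `K[T_σ]` under `T ↦ X_σ`, `U_+(𝔭_{x'})·K[X] = 𝔭_{x'}` (the Hironaka scheme
`B_{g,x'}` is the LINE through `x'`, a vector group — no appeal to Mizutani's bound is needed at a
rational point), and the conclusion of TH IV «generated by elements of `U_{g,x'}`» is EQUIVALENT to the
cylinder condition of §3, hence to the equality of §2. Tool: the grading of `K[X_0, X_σ]` by the
`X_σ`-degree (Mathlib `weightedHomogeneousComponent` for the weight `X_0 ↦ 0`, `X_σ ↦ 1`). -/

section RationalPoint

/-- The weight `X_0 ↦ 0`, `X_i ↦ 1` (`i ∈ σ`): the `X_σ`-degree. (Auxiliary, spelled out inline below as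
`fun o : Option σ => Option.elim o 0 fun _ => (1 : ℕ)`.) Its value on an exponent is the degree of the
`X_σ`-part. [cite: Hironaka1970NumericalCharacters, (13.1) p. 168] -/
theorem weight_optionElim_eq_degree_some (x : Option σ →₀ ℕ) :
    Finsupp.weight (fun o : Option σ => Option.elim o 0 fun _ => (1 : ℕ)) x = x.some.degree := by
  rw [Finsupp.weight_apply, Finsupp.sum_option_index_smul, Finsupp.degree_apply]
  simp only [Option.elim, smul_eq_mul, mul_zero, mul_one, zero_add]
  rfl

/-- The `X_σ`-degree of an exponent is at most its total degree, with equality iff `X_0` does not occur.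
[cite: Hironaka1970NumericalCharacters, (13.1) p. 168] -/
theorem weight_optionElim_add_none_eq_degree (x : Option σ →₀ ℕ) :
    Finsupp.weight (fun o : Option σ => Option.elim o 0 fun _ => (1 : ℕ)) x + x none = x.degree := by
  rw [weight_optionElim_eq_degree_some, degree_eq_none_add_degree_some, add_comm]

/-- If all `X_σ`-degree components below `k₀` of `ψ` vanish, every monomial of `ψ` has `X_σ`-degree `≥ k₀`.
[cite: Hironaka1970NumericalCharacters, (13.1) p. 168] -/
theorem le_weight_of_forall_weightedHomogeneousComponent_eq_zero {ψ : MvPolynomial (Option σ) K}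
    {k₀ : ℕ} (h : ∀ k < k₀, weightedHomogeneousComponent
      (fun o : Option σ => Option.elim o 0 fun _ => (1 : ℕ)) k ψ = 0)
    {x : Option σ →₀ ℕ} (hx : x ∈ ψ.support) :
    k₀ ≤ Finsupp.weight (fun o : Option σ => Option.elim o 0 fun _ => (1 : ℕ)) x := by
  by_contra hlt
  rw [not_le] at hlt
  have h0 := h _ hlt
  have hc := congr_arg (coeff x) h0
  rw [coeff_weightedHomogeneousComponent, if_pos rfl, coeff_zero] at hc
  exact (mem_support_iff.mp hx) hc

/-- The `X_σ`-degrees of the monomials of a product are sums of those of the factors: if they are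
`≥ a` on `r` and `≥ b` on `s` then they are `≥ a + b` on `r * s`. [cite: Hironaka1970NumericalCharacters, (13.1) p. 168] -/
theorem le_weight_of_mem_support_mul {r s : MvPolynomial (Option σ) K} {a b : ℕ}
    (hr : ∀ x ∈ r.support, a ≤ Finsupp.weight (fun o : Option σ => Option.elim o 0 fun _ => (1 : ℕ)) x)
    (hs : ∀ x ∈ s.support, b ≤ Finsupp.weight (fun o : Option σ => Option.elim o 0 fun _ => (1 : ℕ)) x)
    {x : Option σ →₀ ℕ} (hx : x ∈ (r * s).support) :
    a + b ≤ Finsupp.weight (fun o : Option σ => Option.elim o 0 fun _ => (1 : ℕ)) x := by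
  classical
  obtain ⟨y, hy, z, hz, rfl⟩ := Finset.mem_add.mp (support_mul r s hx)
  rw [map_add]
  exact add_le_add (hr y hy) (hs z hz)

/-- A polynomial whose monomials all have `X_σ`-degree `> k` has zero `X_σ`-degree-`k` component.
[cite: Hironaka1970NumericalCharacters, (13.1) p. 168] -/
theorem weightedHomogeneousComponent_eq_zero_of_lt_weight {χ : MvPolynomial (Option σ) K} {k : ℕ}
    (h : ∀ x ∈ χ.support, k + 1 ≤ Finsupp.weight (fun o : Option σ => Option.elim o 0 fun _ => (1 : ℕ)) x) :
    weightedHomogeneousComponent (fun o : Option σ => Option.elim o 0 fun _ => (1 : ℕ)) k χ = 0 :=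
  weightedHomogeneousComponent_eq_zero' _ _ fun x hx heq => by have := h x hx; omega

/-- `ψ` minus its `X_σ`-degree-`k₀` component has all monomials of `X_σ`-degree `≥ k₀ + 1`, provided the
components below `k₀` vanish. [cite: Hironaka1970NumericalCharacters, (13.1) p. 168] -/
theorem succ_le_weight_of_mem_support_sub_weightedHomogeneousComponent {ψ : MvPolynomial (Option σ) K}
    {k₀ : ℕ} (h : ∀ k < k₀, weightedHomogeneousComponent
      (fun o : Option σ => Option.elim o 0 fun _ => (1 : ℕ)) k ψ = 0)
    {x : Option σ →₀ ℕ} (hx : x ∈ (ψ - weightedHomogeneousComponent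
      (fun o : Option σ => Option.elim o 0 fun _ => (1 : ℕ)) k₀ ψ).support) :
    k₀ + 1 ≤ Finsupp.weight (fun o : Option σ => Option.elim o 0 fun _ => (1 : ℕ)) x := by
  have hx' := mem_support_iff.mp hx
  rw [coeff_sub, coeff_weightedHomogeneousComponent] at hx'
  by_cases heq : Finsupp.weight (fun o : Option σ => Option.elim o 0 fun _ => (1 : ℕ)) x = k₀
  · rw [if_pos heq, sub_self] at hx'
    exact (hx' rfl).elim
  · rw [if_neg heq, sub_zero] at hx'
    have hle := le_weight_of_forall_weightedHomogeneousComponent_eq_zero h (mem_support_iff.mpr hx')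
    omega

/-- **Lowest `X_σ`-degree part of a product.** If the `X_σ`-degree components of `φ` below `k₀` vanish,
the `X_σ`-degree-`k₀` component of `s·φ` is `s(X_0, 0) · φ^{(k₀)}` (the `X_σ`-free part of `s` times the
lowest part of `φ`). [cite: Hironaka1970NumericalCharacters, (13.1)–(13.2) p. 168] -/
theorem weightedHomogeneousComponent_mul_of_forall_lt_eq_zero (s φ : MvPolynomial (Option σ) K)
    {k₀ : ℕ} (h : ∀ k < k₀, weightedHomogeneousComponent
      (fun o : Option σ => Option.elim o 0 fun _ => (1 : ℕ)) k φ = 0) :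
    weightedHomogeneousComponent (fun o : Option σ => Option.elim o 0 fun _ => (1 : ℕ)) k₀ (s * φ) =
      weightedHomogeneousComponent (fun o : Option σ => Option.elim o 0 fun _ => (1 : ℕ)) 0 s *
        weightedHomogeneousComponent (fun o : Option σ => Option.elim o 0 fun _ => (1 : ℕ)) k₀ φ := by
  set w : Option σ → ℕ := fun o => Option.elim o 0 fun _ => (1 : ℕ) with hw
  set s₀ := weightedHomogeneousComponent w 0 s
  set φ₀ := weightedHomogeneousComponent w k₀ φ
  have hs' : ∀ x ∈ (s - s₀).support, 0 + 1 ≤ Finsupp.weight w x := fun x hx =>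
    succ_le_weight_of_mem_support_sub_weightedHomogeneousComponent (fun k hk => (Nat.not_lt_zero k hk).elim) hx
  have hφ' : ∀ x ∈ (φ - φ₀).support, k₀ + 1 ≤ Finsupp.weight w x := fun x hx =>
    succ_le_weight_of_mem_support_sub_weightedHomogeneousComponent h hx
  have hs₀ : ∀ x ∈ s₀.support, 0 ≤ Finsupp.weight w x := fun _ _ => Nat.zero_le _
  have hφ : ∀ x ∈ φ.support, k₀ ≤ Finsupp.weight w x := fun x hx =>
    le_weight_of_forall_weightedHomogeneousComponent_eq_zero h hx
  have hdec : s * φ = s₀ * φ₀ + (s₀ * (φ - φ₀) + (s - s₀) * φ) := by ring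
  have hrest : weightedHomogeneousComponent w k₀ (s₀ * (φ - φ₀) + (s - s₀) * φ) = 0 := by
    rw [map_add, weightedHomogeneousComponent_eq_zero_of_lt_weight (fun x hx => by
        have := le_weight_of_mem_support_mul hs₀ hφ' hx; omega),
      weightedHomogeneousComponent_eq_zero_of_lt_weight (fun x hx => by
        have := le_weight_of_mem_support_mul hs' hφ hx; omega), add_zero]
  have hmain : (s₀ * φ₀).IsWeightedHomogeneous w (0 + k₀) :=
    (weightedHomogeneousComponent_isWeightedHomogeneous 0 s).mul
      (weightedHomogeneousComponent_isWeightedHomogeneous k₀ φ)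
  rw [zero_add] at hmain
  rw [hdec, map_add, hrest, add_zero, weightedHomogeneousComponent_eq_self hmain]

/-- **An element off `𝔭_{x'} = (X_σ)` has a non-zero `X_σ`-free part**: if every monomial of `s` involves
some `X_i`, `i ∈ σ`, then `s ∈ (X_σ)`. [cite: Hironaka1970NumericalCharacters, (13.1) p. 168] -/
theorem weightedHomogeneousComponent_zero_ne_zero_of_not_mem {s : MvPolynomial (Option σ) K}
    (hs : s ∉ Ideal.span (Set.range fun i : σ => (X (some i) : MvPolynomial (Option σ) K))) :
    weightedHomogeneousComponent (fun o : Option σ => Option.elim o 0 fun _ => (1 : ℕ)) 0 s ≠ 0 := by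
  classical
  intro h0
  apply hs
  have hwt : ∀ x ∈ s.support,
      1 ≤ Finsupp.weight (fun o : Option σ => Option.elim o 0 fun _ => (1 : ℕ)) x :=
    fun x hx => le_weight_of_forall_weightedHomogeneousComponent_eq_zero
      (fun k hk => by rw [Nat.lt_one_iff.mp hk]; exact h0) hx
  rw [as_sum s]
  refine Ideal.sum_mem _ fun x hx => ?_
  -- a monomial of positive `X_σ`-degree is divisible by some `X_i`
  have h1 := hwt x hx
  rw [weight_optionElim_eq_degree_some, Nat.one_le_iff_ne_zero, ne_eq,
    Finsupp.degree_eq_zero_iff] at h1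
  obtain ⟨i, hi⟩ : ∃ i, x (some i) ≠ 0 := by
    by_contra hall
    refine h1 (Finsupp.ext fun i => ?_)
    rw [Finsupp.some_apply, Finsupp.zero_apply]
    by_contra hne
    exact hall ⟨i, hne⟩
  obtain ⟨c, hc⟩ := le_iff_exists_add'.mp
    (show Finsupp.single (some i) 1 ≤ x from Finsupp.single_le_iff.mpr (Nat.one_le_iff_ne_zero.mpr hi))
  rw [hc, monomial_add_single, pow_one]
  exact Ideal.mul_mem_left _ _ (Ideal.subset_span ⟨i, rfl⟩)

/-- The powers of `𝔭_{x'} = (X_σ)`: every monomial of an element of `𝔭_{x'}^m` has `X_σ`-degree `≥ m`.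
[cite: Hironaka1970NumericalCharacters, (13.1) p. 168] -/
theorem le_weight_of_mem_pow_span_X_some {m : ℕ} {ψ : MvPolynomial (Option σ) K}
    (hψ : ψ ∈ Ideal.span (Set.range fun i : σ => (X (some i) : MvPolynomial (Option σ) K)) ^ m)
    {x : Option σ →₀ ℕ} (hx : x ∈ ψ.support) :
    m ≤ Finsupp.weight (fun o : Option σ => Option.elim o 0 fun _ => (1 : ℕ)) x := by
  classical
  rw [← map_rename_idealOfVars, ← Ideal.map_pow] at hψ
  -- `ψ` is a combination `Σ a_g · rename some g` with `g ∈ 𝔫^m`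
  rw [Ideal.map, ← Ideal.submodule_span_eq] at hψ
  induction hψ using Submodule.span_induction generalizing x with
  | mem g hg =>
    obtain ⟨q, hq, rfl⟩ := hg
    -- monomials of `rename some q` are `x.mapDomain some`, of `X_σ`-degree `= degree`
    rw [weight_optionElim_eq_degree_some]
    obtain ⟨y, hy, rfl⟩ : ∃ y ∈ q.support, Finsupp.mapDomain some y = x := by
      have := support_rename_of_injective (p := q) (Option.some_injective σ)
      rw [this, Finset.mem_image] at hx
      exact hx
    have hsome : (Finsupp.mapDomain (some : σ → Option σ) y).some = y :=
      Finsupp.ext fun i => by rw [Finsupp.some_apply, Finsupp.mapDomain_apply (Option.some_injective σ)]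
    rw [hsome]
    exact (MvPolynomial.mem_pow_idealOfVars_iff m q).mp hq y hy
  | zero => simp at hx
  | add a b _ _ ha hb =>
    rcases Finset.mem_union.mp (support_add hx) with h | h
    · exact ha h
    · exact hb h
  | smul a b _ hb =>
    rw [smul_eq_mul] at hx
    have := le_weight_of_mem_support_mul (a := 0) (fun _ _ => Nat.zero_le _) (fun y hy => hb hy) hx
    simpa using this

/-- **(13.2) at a rational point: the homogeneous elements of `U(𝔭_{x'})` involve the `X_σ` only.** A form
`φ` of degree `d` with `mult_{x'}(φ) ≥ d` (`s·φ ∈ 𝔭_{x'}^d` for some `s ∉ 𝔭_{x'}`) lies in `K[X_σ]`: with `k₀`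
the least `X_σ`-degree occurring in `φ`, the `X_σ`-degree-`k₀` part of `s φ` is `s(X_0,0)·φ^{(k₀)} ≠ 0`, so
`k₀ ≥ d = deg φ` and `X_0` does not occur. [cite: Hironaka1970NumericalCharacters, (13.2) p. 168 L32–38] -/
theorem multGens_span_X_some_subset_range_rename :
    HironakaScheme.multGens K
        (Ideal.span (Set.range fun i : σ => (X (some i) : MvPolynomial (Option σ) K))) ⊆
      Set.range (rename (some : σ → Option σ) : MvPolynomial σ K → MvPolynomial (Option σ) K) := by
  classical
  rintro φ ⟨d, hφd, s, hs, hsφ⟩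
  by_cases hφ0 : φ = 0
  · exact ⟨0, by rw [map_zero, hφ0]⟩
  -- every monomial of `φ` has `X_σ`-degree `≤ d`
  have hup : ∀ x ∈ φ.support, Finsupp.weight (fun o : Option σ => Option.elim o 0 fun _ => (1 : ℕ)) x ≤ d := by
    intro x hx
    have hdeg : x.degree = d := by
      by_contra hne
      exact (mem_support_iff.mp hx) (hφd.coeff_eq_zero hne)
    have := weight_optionElim_add_none_eq_degree x
    omega
  -- the least `X_σ`-degree component
  have hex : ∃ k, weightedHomogeneousComponent (fun o : Option σ => Option.elim o 0 fun _ => (1 : ℕ)) k φ ≠ 0 := by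
    obtain ⟨x, hx⟩ := Finset.nonempty_of_ne_empty (mt MvPolynomial.support_eq_empty.mp hφ0)
    refine ⟨Finsupp.weight (fun o : Option σ => Option.elim o 0 fun _ => (1 : ℕ)) x, fun h0 => ?_⟩
    have hc := congr_arg (coeff x) h0
    rw [coeff_weightedHomogeneousComponent, if_pos rfl, coeff_zero] at hc
    exact (mem_support_iff.mp hx) hc
  set k₀ := Nat.find hex with hk₀
  have hmin : ∀ k < k₀, weightedHomogeneousComponent (fun o : Option σ => Option.elim o 0 fun _ => (1 : ℕ)) k φ = 0 := fun k hk => by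
    have := Nat.find_min hex hk
    rwa [not_not] at this
  have hk₀ne : weightedHomogeneousComponent (fun o : Option σ => Option.elim o 0 fun _ => (1 : ℕ)) k₀ φ ≠ 0 := Nat.find_spec hex
  -- `(sφ)^{(k₀)} = s₀ φ₀ ≠ 0`, while `sφ ∈ 𝔭^d` has no component below `d`: so `d ≤ k₀`
  have hdk : d ≤ k₀ := by
    by_contra hlt
    rw [not_le] at hlt
    have hzero : weightedHomogeneousComponent (fun o : Option σ => Option.elim o 0 fun _ => (1 : ℕ)) k₀ (s * φ) = 0 :=
      weightedHomogeneousComponent_eq_zero' _ _ fun x hx heq => by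
        have := le_weight_of_mem_pow_span_X_some hsφ hx; omega
    rw [weightedHomogeneousComponent_mul_of_forall_lt_eq_zero s φ hmin] at hzero
    rcases mul_eq_zero.mp hzero with h | h
    · exact weightedHomogeneousComponent_zero_ne_zero_of_not_mem hs h
    · exact hk₀ne h
  -- hence every monomial of `φ` has `X_σ`-degree `= d = degree`, i.e. no `X_0`
  refine exists_rename_eq_of_vars_subset_range φ some (Option.some_injective σ) ?_
  intro o ho
  obtain ⟨x, hx, hox⟩ := (mem_vars_iff_mem_support o).mp (Finset.mem_coe.mp ho)
  cases o with
  | some i => exact ⟨i, rfl⟩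
  | none =>
    exfalso
    have h1 := le_weight_of_forall_weightedHomogeneousComponent_eq_zero hmin hx
    have h2 := hup x hx
    have h3 := weight_optionElim_add_none_eq_degree x
    have hdeg : x.degree = d := by
      by_contra hne
      exact (mem_support_iff.mp hx) (hφd.coeff_eq_zero hne)
    have hx0 : x none = 0 := by omega
    exact (Finsupp.mem_support_iff.mp hox) hx0

/-- **[H4] (13.2) at a rational point: `U_{g,x'} = K[X_σ]`** — Hironaka's graded algebra of the rational point
`x' = [1:0:⋯:0]` is the polynomial algebra on the linear forms vanishing at `x'` («`q_i = 1` for all `i`»).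
[cite: Hironaka1970NumericalCharacters, (13.2) p. 168 L32–38] -/
theorem multAlgebra_span_X_some_eq_range_rename :
    (HironakaScheme.multAlgebra K
        (Ideal.span (Set.range fun i : σ => (X (some i) : MvPolynomial (Option σ) K))) :
        Set (MvPolynomial (Option σ) K)) =
      Set.range (rename (some : σ → Option σ) : MvPolynomial σ K → MvPolynomial (Option σ) K) := by
  refine Set.Subset.antisymm ?_ range_rename_some_subset_multAlgebra
  have h : HironakaScheme.multAlgebra K
      (Ideal.span (Set.range fun i : σ => (X (some i) : MvPolynomial (Option σ) K))) ≤
      (rename (some : σ → Option σ) : MvPolynomial σ K →ₐ[K] MvPolynomial (Option σ) K).range := by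
    unfold HironakaScheme.multAlgebra
    exact Algebra.adjoin_le fun g hg => by
      obtain ⟨q, hq⟩ := multGens_span_X_some_subset_range_rename hg
      exact ⟨q, hq⟩
  intro g hg
  obtain ⟨q, hq⟩ := (AlgHom.mem_range _).mp (h hg)
  exact ⟨q, hq⟩

/-- **`U_+(𝔭_{x'})·K[X] = 𝔭_{x'}`: at a rational point the Hironaka scheme `B_{g,x'} = Spec(S/U_+S)` is the
LINE through `x'`.** [cite: Hironaka1970NumericalCharacters, (13.2) p. 168 L32–38]
[cite: Mizutani1973HironakaGroupSchemes, Def. 1.1] -/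
theorem bIdeal_span_X_some_eq :
    HironakaScheme.bIdeal K
        (Ideal.span (Set.range fun i : σ => (X (some i) : MvPolynomial (Option σ) K))) =
      Ideal.span (Set.range fun i : σ => (X (some i) : MvPolynomial (Option σ) K)) := by
  classical
  refine le_antisymm ?_ ?_
  · rw [HironakaScheme.bIdeal, Ideal.span_le]
    rintro g ⟨hgU, hg0⟩
    rw [multAlgebra_span_X_some_eq_range_rename] at hgU
    obtain ⟨q, rfl⟩ := hgU
    rw [Set.mem_setOf_eq, constantCoeff_rename] at hg0
    rw [SetLike.mem_coe, ← map_rename_idealOfVars]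
    refine Ideal.mem_map_of_mem _ ?_
    rw [← pow_one (MvPolynomial.idealOfVars σ K), MvPolynomial.mem_pow_idealOfVars_iff']
    intro x hx
    obtain rfl : x = 0 := by
      rwa [Nat.lt_one_iff, Finsupp.degree_eq_zero_iff] at hx
    exact hg0
  · rw [Ideal.span_le]
    rintro _ ⟨i, rfl⟩
    refine Ideal.subset_span ⟨range_rename_some_subset_multAlgebra ⟨X i, rename_X _ _⟩, ?_⟩
    exact constantCoeff_X K (some i)

/-- **At a rational point the Hironaka scheme is a vector group** (its ideal `𝔭_{x'} = (X_σ)` is generated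
by linear forms) — without Mizutani's dimension bound. [cite: Mizutani1973HironakaGroupSchemes, Def. 1.1, Rem. 1.2]
[cite: Hironaka1970NumericalCharacters, (13.2) p. 168 L32–38] -/
theorem isVectorGroup_span_X_some :
    HironakaScheme.IsVectorGroup K
      (Ideal.span (Set.range fun i : σ => (X (some i) : MvPolynomial (Option σ) K))) := by
  rw [HironakaScheme.IsVectorGroup, bIdeal_span_X_some_eq]
  refine le_antisymm (Ideal.span_le.mpr ?_) (Ideal.span_le.mpr Set.inter_subset_left)
  rintro _ ⟨i, rfl⟩
  exact Ideal.subset_span ⟨Ideal.subset_span ⟨i, rfl⟩, isHomogeneous_X K (some i)⟩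

/-- **The four readings of «`C_{X,x}` is invariant by `B_{g,x'}`» agree at a rational point**: for ANY ideal
`J`, generation by elements of `U(𝔭_{x'})` is the same as generation by elements not involving `X_0`
(cylinder along `x'`). [cite: Hironaka1970NumericalCharacters, (14.3) p. 170 L3–9] -/
theorem le_span_inter_multAlgebra_iff_le_span_inter_range_rename {J : Ideal (MvPolynomial (Option σ) K)} :
    J ≤ Ideal.span ((J : Set (MvPolynomial (Option σ) K)) ∩
      (HironakaScheme.multAlgebra K
        (Ideal.span (Set.range fun i : σ => (X (some i) : MvPolynomial (Option σ) K))) :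
        Set (MvPolynomial (Option σ) K))) ↔
    J ≤ Ideal.span ((J : Set (MvPolynomial (Option σ) K)) ∩
      Set.range (rename (some : σ → Option σ))) := by
  rw [multAlgebra_span_X_some_eq_range_rename]

variable [Fintype σ]

/-- **[H4] TH III ⟺ TH IV at a rational point, closed loop.** For a homogeneous ideal `J ⊆ K[X_0,X_σ]` the
following are equivalent: (a) the truncated colengths of the dehomogenised ideal at `x' = [1:0:⋯:0]`
attain the TH II bound for every `n`; (b) `J` is generated by its elements in `U(𝔭_{x'})` (invariance of the
cone under `B_{g,x'}`, p. 170 L3–4). [cite: Hironaka1970NumericalCharacters, TH III–IV p. 156 L7–12, (14.3) p. 170 L3–9] -/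
theorem forall_finrank_eq_iff_le_span_inter_multAlgebra {J : Ideal (MvPolynomial (Option σ) K)}
    (hJ : ∀ f ∈ J, ∀ d : ℕ, homogeneousComponent d f ∈ J) :
    (∀ n, finrank K (MvPolynomial σ K ⧸ (J.map (dehomogenization (R := K) (σ := σ)) ⊔
        MvPolynomial.idealOfVars σ K ^ (n + 1))) +
      finrank K (idealDegree J n) = finrank K (homogeneousSubmodule (Option σ) K n)) ↔
    J ≤ Ideal.span ((J : Set (MvPolynomial (Option σ) K)) ∩
      (HironakaScheme.multAlgebra K
        (Ideal.span (Set.range fun i : σ => (X (some i) : MvPolynomial (Option σ) K))) :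
        Set (MvPolynomial (Option σ) K))) := by
  rw [le_span_inter_multAlgebra_iff_le_span_inter_range_rename]
  exact forall_finrank_eq_iff_le_span_inter_range_rename hJ

end RationalPoint

end Literature.AlgebraicGeometry.Resolution

end
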